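import Summits.FinalStateConjecture.FinalStateConjecture.Theorems.EIHFluxBalanceInertialRecessionFermiMap
import Summits.FinalStateConjecture.FinalStateConjecture.Theorems.EIHFluxBalanceInertialRecessionHoleLimit
import Mathlib.Geometry.Manifold.PartitionOfUnity

/-!
# Route EIHFluxBalance — `InertialRecession`: the `a = 0` hole-chart package

Helper file for the crux `stmt-FinalStateConjecture-10166`
(`Summit.FinalStateConjecture.FinalStateConjecture.Theses.EIHFluxBalance.InertialRecession`).

Assembly of the hole chart of a receding Schwarzschild hole: the excision profile `ρ`
(`exists_contDiff_between`, `exists_excisionProfile`: a smooth `ρ → ∞`, `ρ ≥ 2r₊ + 2`, with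
`2ρ + r₊ⱼ ≤ ‖ξᵢ − ξⱼ‖` eventually), the image of the Fermi-type re-charting map (`fermiMap_late_and_radii`:
every model point of the boosted exterior is sent to a lab point of lab time `> T` lying OUTSIDE
EVERY painted horizon — exactly, for the own hole, by the horizon normalisation), and the package
`hole_chart_package'` (registered form unprimed): smooth open embedding `A`, honest on the honest zone, image control, and the
near-zone `C²` convergence of `Φ ∘ A` for every fixed radius (`…HoleLimit`).
-/

noncomputable section

open scoped Topology ContDiff InnerProductSpace BigOperators Manifold ENNReal
open Filter Set Metric Function TopologicalSpace Literature.Geometry.Lorentzian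

namespace Summit.FinalStateConjecture.FinalStateConjecture.Theorems

/-! ### A smooth function between two continuous ones -/

/-- Between two continuous functions `l < u` on `ℝ` there is a smooth one (smooth partition of
unity, `exists_contMDiffMap_forall_mem_convex_of_local_const`). [folklore] -/
theorem exists_contDiff_between {l u : ℝ → ℝ} (hl : Continuous l) (hu : Continuous u)
    (h : ∀ x, l x < u x) : ∃ ρ : ℝ → ℝ, ContDiff ℝ ∞ ρ ∧ ∀ x, l x < ρ x ∧ ρ x < u x := by
  have ht : ∀ x : ℝ, Convex ℝ (Set.Ioo (l x) (u x)) := fun x ↦ convex_Ioo _ _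
  have Hloc : ∀ x : ℝ, ∃ c : ℝ, ∀ᶠ y in 𝓝 x, c ∈ Set.Ioo (l y) (u y) := by
    intro x
    refine ⟨(l x + u x) / 2, ?_⟩
    have h1 : ∀ᶠ y in 𝓝 x, l y < (l x + u x) / 2 :=
      hl.continuousAt.eventually_lt continuousAt_const (by linarith [h x])
    have h2 : ∀ᶠ y in 𝓝 x, (l x + u x) / 2 < u y :=
      continuousAt_const.eventually_lt hu.continuousAt (by linarith [h x])
    filter_upwards [h1, h2] with y hy1 hy2
    exact ⟨hy1, hy2⟩
  obtain ⟨g, hg⟩ := exists_contMDiffMap_forall_mem_convex_of_local_const 𝓘(ℝ, ℝ) ht Hloc (n := (⊤ : ℕ∞))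
  refine ⟨g, ?_, fun x ↦ hg x⟩
  exact contMDiff_iff_contDiff.1 g.contMDiff

/-! ### The excision profile of a receding hole -/

/-- **Excision profile.** If every other hole recedes from hole `i` (`‖ξᵢ − ξⱼ‖ → ∞`, continuous
centres), then for every `r` there are a smooth `ρ` with `ρ ≥ r + 2`, `ρ → ∞`, and a time `T`
after which `2ρ(θ) + r ≤ ‖ξᵢ(θ) − ξⱼ(θ)‖` for all `j ≠ i`. [folklore] -/
theorem exists_excisionProfile {N : ℕ} (i : Fin N) (ξ : Fin N → ℝ → E3) (hξc : ∀ j, Continuous (ξ j))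
    (hsep : ∀ j ≠ i, Tendsto (fun t ↦ ‖ξ i t - ξ j t‖) atTop atTop) (r : ℝ) :
    ∃ ρ : ℝ → ℝ, ContDiff ℝ ∞ ρ ∧ (∀ θ, r + 2 ≤ ρ θ) ∧ Tendsto ρ atTop atTop ∧
      ∃ T : ℝ, ∀ θ, T ≤ θ → ∀ j ≠ i, 2 * ρ θ + r ≤ ‖ξ i θ - ξ j θ‖ := by
  classical
  -- `m(θ) = min(θ, min_{j ≠ i} ‖ξᵢ − ξⱼ‖)`
  set f : Fin N → ℝ → ℝ := fun j θ ↦ if j = i then θ else ‖ξ i θ - ξ j θ‖ with hf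
  have hne : (Finset.univ : Finset (Fin N)).Nonempty := ⟨i, Finset.mem_univ i⟩
  set m : ℝ → ℝ := fun θ ↦ Finset.univ.inf' hne fun j ↦ f j θ with hm
  have hfc : ∀ j, Continuous (f j) := by
    intro j
    by_cases hj : j = i
    · simp only [hf, hj, if_true]; exact continuous_id
    · simp only [hf, hj, if_false]; exact ((hξc i).sub (hξc j)).norm
  have hmc : Continuous m := Continuous.finset_inf'_apply hne fun j _ ↦ hfc j
  have hmle : ∀ θ j, m θ ≤ f j θ := fun θ j ↦ Finset.inf'_le _ (Finset.mem_univ j)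
  have hmt : Tendsto m atTop atTop := by
    refine tendsto_atTop.2 fun b ↦ ?_
    have h : ∀ j, ∀ᶠ θ in atTop, b ≤ f j θ := by
      intro j
      by_cases hj : j = i
      · simp only [hf, hj, if_true]; exact eventually_ge_atTop b
      · simp only [hf, hj, if_false]; exact (hsep j hj).eventually (eventually_ge_atTop b)
    filter_upwards [eventually_all.2 h] with θ hθ
    exact Finset.le_inf' hne _ fun j _ ↦ hθ j
  -- a smooth function between `u − 1` and `u`, `u = max (r + 3) ((m − r)/2)`
  set u : ℝ → ℝ := fun θ ↦ max (r + 3) ((m θ - r) / 2) with hu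
  have huc : Continuous u := continuous_const.max ((hmc.sub continuous_const).div_const _)
  obtain ⟨ρ, hρc, hρb⟩ := exists_contDiff_between (l := fun θ ↦ u θ - 1) (huc.sub continuous_const)
    huc fun θ ↦ by linarith
  refine ⟨ρ, hρc, fun θ ↦ ?_, ?_, ?_⟩
  · have := (hρb θ).1
    have : r + 3 ≤ u θ := le_max_left _ _
    linarith
  · refine tendsto_atTop_mono (fun θ ↦ (hρb θ).1.le) ?_
    have h1 : Tendsto (fun θ ↦ (m θ - r) / 2 - 1) atTop atTop := by
      refine tendsto_atTop_add_const_right _ _ (Tendsto.atTop_div_const (by norm_num) ?_)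
      exact tendsto_atTop_add_const_right _ _ hmt
    exact tendsto_atTop_mono (fun θ ↦ by simp only [hu]; linarith [le_max_right (r + 3) ((m θ - r) / 2)]) h1
  · obtain ⟨T, hT⟩ := eventually_atTop.1 (tendsto_atTop.1 hmt (2 * (r + 3) + r))
    refine ⟨T, fun θ hθ j hj ↦ ?_⟩
    have hmθ := hT θ hθ
    have hu2 : u θ = (m θ - r) / 2 := by
      refine max_eq_right ?_
      linarith
    have h1 := (hρb θ).2
    rw [hu2] at h1
    have h2 : m θ ≤ ‖ξ i θ - ξ j θ‖ := by
      have := hmle θ j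
      simp only [hf, hj, if_false] at this
      exact this
    linarith

/-! ### Late near zones of two receding holes are disjoint -/

/-- **Late near zones of two receding holes are disjoint in the lab.** If `‖ξᵢ − ξₖ‖ → ∞` then for
every `R` there is a lab time `W` after which no lab point lies within lab distance `R` of both
painted centres on the same lab slab: `(w, ξᵢ(w) + p) ≠ (w', ξₖ(w') + q)` for `w, w' ≥ W`,
`‖p‖, ‖q‖ ≤ R` (the honest hole charts place the near zone `{r ≤ R}` within lab distance `R` of the
centre, `‖L_v y̲‖ ≤ ‖y̲‖`; with the injectivity of the lab chart this is the clause
`exists_pairwise_disjoint`). [folklore] -/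
theorem late_nearZones_disjoint {ξ₁ ξ₂ : ℝ → E3}
    (hsep : Tendsto (fun t ↦ ‖ξ₁ t - ξ₂ t‖) atTop atTop) (R : ℝ) :
    ∃ W : ℝ, ∀ w w' : ℝ, W ≤ w → W ≤ w' → ∀ p q : E3, ‖p‖ ≤ R → ‖q‖ ≤ R →
      E4.ofTimeSpace w (ξ₁ w + p) ≠ E4.ofTimeSpace w' (ξ₂ w' + q) := by
  obtain ⟨W, hW⟩ := eventually_atTop.1 (tendsto_atTop.1 hsep (2 * R + 1))
  refine ⟨W, fun w w' hw hw' p q hp hq h ↦ ?_⟩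
  have h0 : w = w' := by
    have := congrArg (fun z : E4 ↦ z 0) h
    simpa using this
  subst h0
  have h1 : ξ₁ w + p = ξ₂ w + q := by
    have := congrArg E4.spatial h
    simpa using this
  have h2 : ξ₁ w - ξ₂ w = q - p := by
    have : ξ₁ w = ξ₂ w + q - p := eq_sub_of_add_eq h1
    rw [this]
    abel
  have h3 : ‖ξ₁ w - ξ₂ w‖ ≤ 2 * R := by
    rw [h2]
    exact (norm_sub_le q p).trans (by linarith)
  linarith [hW w hw]

/-! ### The image of the Fermi-type map -/

section Image

variable {N : ℕ} (i : Fin N) (M : Fin N → ℝ) (Λ : Fin N → ℝ → lorentzGroup) (ξ v : Fin N → ℝ → E3)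
  (hfut : ∀ j t, 0 < (((Λ j t : E4 ≃L[ℝ] E4) (E4.basisVector 0)) 0))
  (hvΛ : ∀ j t, E4.spatial ((Λ j t : E4 ≃L[ℝ] E4) (E4.basisVector 0)) =
    (((Λ j t : E4 ≃L[ℝ] E4) (E4.basisVector 0)) 0) • v j t)
  {V : E3} (hV : ‖V‖ < 1) {σ Gt ρ : ℝ → ℝ} {T : ℝ} {A : E4 → E4}
  (hA : ∀ x : E4, A x =
    E4.ofTimeSpace (T + 1 + σ (x 0 - T - 1))
      (ξ i (T + 1 + σ (x 0 - T - 1)) +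
        ((ρ (T + 1 + σ (x 0 - T - 1)) • (WithLp.toLp 2 fun k ↦ Gt ((ρ (T + 1 + σ (x 0 - T - 1)))⁻¹ *
            E4.spatial ((Lorentz.boost V hV : E4 ≃L[ℝ] E4).symm x) k) : E3)) -
          (Lorentz.gamma (v i (T + 1 + σ (x 0 - T - 1))) /
              (Lorentz.gamma (v i (T + 1 + σ (x 0 - T - 1))) + 1) *
            inner ℝ (v i (T + 1 + σ (x 0 - T - 1)))
              (ρ (T + 1 + σ (x 0 - T - 1)) • (WithLp.toLp 2 fun k ↦
                Gt ((ρ (T + 1 + σ (x 0 - T - 1)))⁻¹ *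
                  E4.spatial ((Lorentz.boost V hV : E4 ≃L[ℝ] E4).symm x) k) : E3))) •
            v i (T + 1 + σ (x 0 - T - 1)))))

include hfut hvΛ hA in
/-- **The image of the Fermi-type map lies outside every painted horizon.** For every model point
with rest offset `‖y̲‖ > r₊ᵢ` the lab point `A x'` has lab time `> T` and painted spin-`0`
Kerr–Schild radius `> r₊ⱼ` with respect to EVERY hole `j`: the own one exactly by the horizon
normalisation (`≥ min(‖y̲‖, ρ/2) > r₊ᵢ` as `ρ ≥ 2r₊ᵢ + 2`), the others by recession
(`2ρ(θ) + r₊ⱼ ≤ ‖ξᵢ(θ) − ξⱼ(θ)‖` for `θ > T`, lab offset `< 2ρ(θ)`, boosts stretch). [folklore] -/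
theorem fermiMap_late_and_radii (hσ1 : ∀ s, -1 < σ s) (hGid : ∀ u, |u| ≤ 1 / 2 → Gt u = u)
    (hGgt : ∀ u, 1 / 2 < |u| → 1 / 2 < |Gt u|) (hGle : ∀ u, |Gt u| ≤ |u|) (hGlt : ∀ u, |Gt u| < 1)
    (hρ0 : ∀ t, 0 < ρ t) (hv1 : ∀ t, ‖v i t‖ < 1)
    (hρr : ∀ θ, 2 * Kerr.rPlus (M i) 0 + 2 ≤ ρ θ)
    (hρsep : ∀ θ, T < θ → ∀ j ≠ i, 2 * ρ θ + Kerr.rPlus (M j) 0 ≤ ‖ξ i θ - ξ j θ‖) (x : E4)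
    (hx : Kerr.rPlus (M i) 0 < ‖E4.spatial ((Lorentz.boost V hV : E4 ≃L[ℝ] E4).symm x)‖) :
    T < A x 0 ∧ ∀ j, Kerr.rPlus (M j) 0 <
      Kerr.radius 0 (poincareInv (Λ j (A x 0)) (E4.ofTimeSpace (A x 0) (ξ j (A x 0))) (A x)) := by
  have hT : T < A x 0 := lt_fermiMap_apply_zero hV hA hσ1 x
  refine ⟨hT, fun j ↦ ?_⟩
  set θ := A x 0 with hθ
  by_cases hj : j = i
  · subst hj
    -- own hole: exact horizon normalisation
    obtain ⟨hlow, -⟩ := spatialNorm_symm_fermiMap_sub' hV hA hGid hGgt hGle hρ0 x (Λ j θ)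
      (hfut j θ) (hvΛ j θ)
    rw [radius_poincareInv_eq, Kerr.radius_zero_left, ContinuousLinearEquiv.coe_coe]
    refine lt_of_lt_of_le ?_ hlow
    refine lt_min hx ?_
    have := hρr θ
    linarith
  · -- other holes: recession
    obtain ⟨h0, hn⟩ := sub_ofTimeSpace_apply_zero (rfl : A x 0 = θ) (ξ j θ)
    have h1 := norm_le_spatialNorm_lorentz_apply (Λ j θ)⁻¹ h0
    rw [coe_lorentz_inv] at h1
    rw [radius_poincareInv_eq, Kerr.radius_zero_left, ContinuousLinearEquiv.coe_coe]
    refine lt_of_lt_of_le ?_ h1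
    rw [hn]
    have hoff := norm_spatial_fermiMap_sub_lt hV hA hGlt hρ0 hv1 x
    rw [← hθ] at hoff
    have hsep := hρsep θ hT j hj
    have htri : ‖ξ i θ - ξ j θ‖ ≤ ‖E4.spatial (A x) - ξ j θ‖ + ‖E4.spatial (A x) - ξ i θ‖ := by
      have := norm_sub_le (E4.spatial (A x) - ξ j θ) (E4.spatial (A x) - ξ i θ)
      have e : E4.spatial (A x) - ξ j θ - (E4.spatial (A x) - ξ i θ) = ξ i θ - ξ j θ := by abel
      rwa [e] at this
    linarith

include hA in
/-- **The honest chart covers the painted near zone.** Every lab point `x` of lab time `x⁰ ≥ T + 1`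
whose painted rest offset `y̲ = P_{vᵢ(x⁰)}(x̲ − ξᵢ(x⁰))` has `‖y̲‖ ≤ ρ(x⁰)/2` is `A x'` for the model
point `x' = Λ∞ (x⁰/γ − ⟪V, y̲⟫, y̲)`, of model time `x⁰/γ − ⟪V, y̲⟫` and model radius `‖y̲‖`
(`L_v ∘ P_v = id`). [folklore] -/
theorem fermiMap_honest_surjective (hσid : ∀ s, 0 ≤ s → σ s = s)
    (hGid : ∀ u, |u| ≤ 1 / 2 → Gt u = u) (hρ0 : ∀ t, 0 < ρ t) (hv1 : ∀ t, ‖v i t‖ < 1) (x : E4)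
    (hx0 : T + 1 ≤ x 0)
    (hy : ‖E4.spatial x - ξ i (x 0) + (Lorentz.gamma (v i (x 0)) ^ 2 / (Lorentz.gamma (v i (x 0)) + 1) *
      inner ℝ (v i (x 0)) (E4.spatial x - ξ i (x 0))) • v i (x 0)‖ ≤ ρ (x 0) / 2) :
    ∃ x' : E4, A x' = x ∧ x' 0 = x 0 ∧
      E4.spatial ((Lorentz.boost V hV : E4 ≃L[ℝ] E4).symm x') = E4.spatial x - ξ i (x 0) +
        (Lorentz.gamma (v i (x 0)) ^ 2 / (Lorentz.gamma (v i (x 0)) + 1) *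
          inner ℝ (v i (x 0)) (E4.spatial x - ξ i (x 0))) • v i (x 0) ∧
      ((Lorentz.boost V hV : E4 ≃L[ℝ] E4).symm x') 0 =
        x 0 / Lorentz.gamma V - inner ℝ V (E4.spatial x - ξ i (x 0) +
          (Lorentz.gamma (v i (x 0)) ^ 2 / (Lorentz.gamma (v i (x 0)) + 1) *
            inner ℝ (v i (x 0)) (E4.spatial x - ξ i (x 0))) • v i (x 0)) := by
  set yb : E3 := E4.spatial x - ξ i (x 0) + (Lorentz.gamma (v i (x 0)) ^ 2 /
    (Lorentz.gamma (v i (x 0)) + 1) * inner ℝ (v i (x 0)) (E4.spatial x - ξ i (x 0))) • v i (x 0) with hyb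
  set y : E4 := E4.ofTimeSpace (x 0 / Lorentz.gamma V - inner ℝ V yb) yb with hy'
  set x' : E4 := (Lorentz.boost V hV : E4 ≃L[ℝ] E4) y with hx'
  have hγ := Lorentz.gamma_pos hV
  have hsymm : (Lorentz.boost V hV : E4 ≃L[ℝ] E4).symm x' = y := by
    rw [hx', ContinuousLinearEquiv.symm_apply_apply]
  have hx'0 : x' 0 = x 0 := by
    rw [hx', Lorentz.coe_boost_apply, Lorentz.boostCLM_apply_zero, hy', E4.ofTimeSpace_apply_zero,
      E4.spatial_ofTimeSpace]
    field_simp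
    ring
  have hsp : E4.spatial ((Lorentz.boost V hV : E4 ≃L[ℝ] E4).symm x') = yb := by
    rw [hsymm, hy', E4.spatial_ofTimeSpace]
  refine ⟨x', ?_, hx'0, hsp, by rw [hsymm, hy', E4.ofTimeSpace_apply_zero]⟩
  have hhon := fermiMap_eq_of_honest hV hA hσid hGid hρ0 (x := x') (by rw [hx'0]; exact hx0)
    (by rw [hsp, hx'0]; exact hy)
  rw [hhon, hsp, hx'0, hyb, restOffset_rightInverse (hv1 (x 0)), add_sub_cancel]
  exact E4.ofTimeSpace_time_spatial x

end Image

/-! ### The package -/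

section Package

variable (𝓢 : Spacetime 4) {N : ℕ} (i : Fin N) (M : Fin N → ℝ) (Λ : Fin N → ℝ → lorentzGroup)
  (ξ v : Fin N → ℝ → E3)
  (hfut : ∀ j t, 0 < (((Λ j t : E4 ≃L[ℝ] E4) (E4.basisVector 0)) 0))
  (hvΛ : ∀ j t, E4.spatial ((Λ j t : E4 ≃L[ℝ] E4) (E4.basisVector 0)) =
    (((Λ j t : E4 ≃L[ℝ] E4) (E4.basisVector 0)) 0) • v j t)
  (U : Opens E4) (Φ : U → 𝓢.carrier) (hΦ : ContMDiff 𝓘(ℝ, E4) (𝓡 4) ∞ Φ)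
  (hdev : Tendsto (fun t ↦ 𝓢.deviationCk ⟨U, fun x ↦ Minkowski.bilin +
    ∑ j, (boostedKerrBilin (Λ j (x 0)) (E4.ofTimeSpace (x 0) (ξ j (x 0))) (M j) 0 x -
      Minkowski.bilin), fun x ↦ x 0, E4.spatialNorm⟩ Φ 2 t) atTop (𝓝 0))
  {κ₀ : ℝ} (hκ₀ : κ₀ < 1) (hvs : ∀ j t, ‖v j t‖ ≤ κ₀)
  (hv : ∀ j, ContDiff ℝ ∞ (v j)) (hξ : ∀ j, ContDiff ℝ ∞ (ξ j)) {Γ T₀ : ℝ}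
  (hvb : ∀ j t, T₀ ≤ t → ∀ l, 1 ≤ l → l ≤ 2 → ‖iteratedDeriv l (v j) t‖ ≤ Γ)
  (hξb : ∀ j t, T₀ ≤ t → ∀ l, 1 ≤ l → l ≤ 2 → ‖iteratedDeriv l (ξ j) t‖ ≤ Γ)
  (hsep : ∀ j ≠ i, Tendsto (fun t ↦ ‖ξ i t - ξ j t‖) atTop atTop) (hMi : 0 < M i) {V : E3}
  (hV : ‖V‖ < 1) (hvV : Tendsto (v i) atTop (𝓝 V)) (hξV : Tendsto (deriv (ξ i)) atTop (𝓝 V))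
  (hξ0 : ∀ l, 2 ≤ l → l ≤ 3 → Tendsto (fun t ↦ iteratedDeriv l (ξ i) t) atTop (𝓝 0))
  (hv0 : ∀ l, 1 ≤ l → l ≤ 3 → Tendsto (fun t ↦ iteratedDeriv l (v i) t) atTop (𝓝 0))
  {τ₀ : ℝ} {rin : Fin N → ℝ} (hrin : ∀ j, rin j < Kerr.rPlus (M j) 0)
  (hU : {x : E4 | τ₀ < x 0 ∧ ∀ j, rin j < Kerr.radius 0 (poincareInv (Λ j (x 0))
    (E4.ofTimeSpace (x 0) (ξ j (x 0))) x)} ⊆ (U : Set E4))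

include hfut hvΛ hΦ hdev hκ₀ hvs hv hξ hvb hξb hsep hMi hvV hξV hξ0 hv0 hrin hU in
-- long chain of bookkeeping
set_option maxHeartbeats 800000 in
/-- **The `a = 0` hole-chart package.** Under the crux data for spins `0` (orthochronous painted
frames with lab velocities `‖vⱼ‖ ≤ κ₀ < 1`, lab-slab `C²` convergence, `U` containing the late
region outside the painted balls of radii `rinⱼ < r₊ⱼ`), eventual bounds on two derivatives of all
`vⱼ, ξⱼ`, recession of the other holes from hole `i`, and the kinematic limits of hole `i`, there are
a late time `T ≥ τ₀`, a smooth excision profile `ρ → ∞`, `ρ > 0`, and a smooth open embedding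
`A : E4 → E4` mapping the boosted Schwarzschild exterior of the final motion `(boost V, 0, Mᵢ)` into
`U` — every model point to a lab point of lab time `> T` within lab distance `2ρ` of the painted
centre, outside EVERY painted horizon when `‖y̲‖ > r₊ᵢ` (exactly, for the own one) — equal to the
honest placement on the honest zone `{x'⁰ ≥ T + 1, ‖y̲‖ ≤ ρ(x'⁰)/2}`, and such that the hole chart
`ψ = Φ ∘ A` has `C²` deviation from boosted Schwarzschild on the truncated slabs `{t* = τ, r ≤ R}`
tending to `0` for every `R`. [folklore] -/
theorem hole_chart_package' :
    ∃ (T : ℝ) (ρ : ℝ → ℝ) (A : E4 → E4)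
      (hAU : ∀ y ∈ boostedKerrExterior (Lorentz.boost V hV) 0 (M i) 0, A y ∈ U),
      τ₀ ≤ T ∧ ContDiff ℝ ∞ A ∧ Topology.IsOpenEmbedding A ∧ ContDiff ℝ ∞ ρ ∧
      Tendsto ρ atTop atTop ∧ (∀ t, 0 < ρ t) ∧
      (∀ x : E4, T < A x 0 ∧ ‖E4.spatial (A x) - ξ i (A x 0)‖ < 2 * ρ (A x 0)) ∧
      (∀ x : E4, Kerr.rPlus (M i) 0 < ‖E4.spatial ((Lorentz.boost V hV : E4 ≃L[ℝ] E4).symm x)‖ →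
        ∀ j, Kerr.rPlus (M j) 0 <
          Kerr.radius 0 (poincareInv (Λ j (A x 0)) (E4.ofTimeSpace (A x 0) (ξ j (A x 0))) (A x))) ∧
      (∀ x : E4, T + 1 ≤ x 0 →
        ‖E4.spatial ((Lorentz.boost V hV : E4 ≃L[ℝ] E4).symm x)‖ ≤ ρ (x 0) / 2 →
        A x = E4.ofTimeSpace (x 0) (ξ i (x 0) +
          (E4.spatial ((Lorentz.boost V hV : E4 ≃L[ℝ] E4).symm x) -
            (Lorentz.gamma (v i (x 0)) / (Lorentz.gamma (v i (x 0)) + 1) *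
              inner ℝ (v i (x 0)) (E4.spatial ((Lorentz.boost V hV : E4 ≃L[ℝ] E4).symm x))) •
              v i (x 0)))) ∧
      ∀ (ψ : boostedKerrExterior (Lorentz.boost V hV) 0 (M i) 0 → 𝓢.carrier),
        (∀ y, ψ y = Φ ⟨A y.1, hAU y.1 y.2⟩) → ∀ R : ℝ,
          Tendsto (fun τ ↦ 𝓢.truncDeviationCk (boostedKerrBackground (Lorentz.boost V hV) 0 (M i) 0)
            ψ 2 R τ) atTop (𝓝 0) := by
  have hv1 : ∀ j t, ‖v j t‖ < 1 := fun j t ↦ (hvs j t).trans_lt hκ₀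
  -- clamps and profile
  obtain ⟨σ, hσ, hσm, hσ1, hσid, hσle, hσ'⟩ := exists_strictTimeClamp'
  obtain ⟨Gt, hGt, hGm, hGlt, hGid, hGgt, hGle, hGd⟩ := exists_coordClamp'
  set r : ℝ := 2 * ∑ j, Kerr.rPlus (M j) 0 with hr
  have hrj0 : ∀ j, 0 ≤ Kerr.rPlus (M j) 0 := by
    intro j
    have h1 : 0 ≤ √(M j ^ 2 - 0 ^ 2) := Real.sqrt_nonneg _
    have h2 : |M j| ≤ √(M j ^ 2 - 0 ^ 2) := by
      rw [show M j ^ 2 - 0 ^ 2 = M j ^ 2 by ring, Real.sqrt_sq_eq_abs]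
    show 0 ≤ M j + √(M j ^ 2 - 0 ^ 2)
    linarith [neg_abs_le (M j)]
  have hrj : ∀ j, Kerr.rPlus (M j) 0 ≤ ∑ j, Kerr.rPlus (M j) 0 := fun j ↦
    Finset.single_le_sum (f := fun j ↦ Kerr.rPlus (M j) 0) (fun j _ ↦ hrj0 j) (Finset.mem_univ j)
  have hsum0 : 0 ≤ ∑ j, Kerr.rPlus (M j) 0 := Finset.sum_nonneg fun j _ ↦ hrj0 j
  obtain ⟨ρ, hρc, hρr, hρt, T', hT'⟩ := exists_excisionProfile i ξ (fun j ↦ (hξ j).continuous) hsep r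
  have hρ0 : ∀ t, 0 < ρ t := fun t ↦ by have := hρr t; rw [hr] at this; linarith
  set T : ℝ := max T' τ₀ with hT
  -- the map
  set A : E4 → E4 := fun x ↦ E4.ofTimeSpace (T + 1 + σ (x 0 - T - 1))
      (ξ i (T + 1 + σ (x 0 - T - 1)) +
        ((ρ (T + 1 + σ (x 0 - T - 1)) • (WithLp.toLp 2 fun k ↦ Gt ((ρ (T + 1 + σ (x 0 - T - 1)))⁻¹ *
            E4.spatial ((Lorentz.boost V hV : E4 ≃L[ℝ] E4).symm x) k) : E3)) -
          (Lorentz.gamma (v i (T + 1 + σ (x 0 - T - 1))) /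
              (Lorentz.gamma (v i (T + 1 + σ (x 0 - T - 1))) + 1) *
            inner ℝ (v i (T + 1 + σ (x 0 - T - 1)))
              (ρ (T + 1 + σ (x 0 - T - 1)) • (WithLp.toLp 2 fun k ↦
                Gt ((ρ (T + 1 + σ (x 0 - T - 1)))⁻¹ *
                  E4.spatial ((Lorentz.boost V hV : E4 ≃L[ℝ] E4).symm x) k) : E3))) •
            v i (T + 1 + σ (x 0 - T - 1)))) with hAdef
  have hA : ∀ x : E4, A x = E4.ofTimeSpace (T + 1 + σ (x 0 - T - 1))
      (ξ i (T + 1 + σ (x 0 - T - 1)) +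
        ((ρ (T + 1 + σ (x 0 - T - 1)) • (WithLp.toLp 2 fun k ↦ Gt ((ρ (T + 1 + σ (x 0 - T - 1)))⁻¹ *
            E4.spatial ((Lorentz.boost V hV : E4 ≃L[ℝ] E4).symm x) k) : E3)) -
          (Lorentz.gamma (v i (T + 1 + σ (x 0 - T - 1))) /
              (Lorentz.gamma (v i (T + 1 + σ (x 0 - T - 1))) + 1) *
            inner ℝ (v i (T + 1 + σ (x 0 - T - 1)))
              (ρ (T + 1 + σ (x 0 - T - 1)) • (WithLp.toLp 2 fun k ↦
                Gt ((ρ (T + 1 + σ (x 0 - T - 1)))⁻¹ *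
                  E4.spatial ((Lorentz.boost V hV : E4 ≃L[ℝ] E4).symm x) k) : E3))) •
            v i (T + 1 + σ (x 0 - T - 1)))) := fun x ↦ rfl
  -- image control
  have hρr' : ∀ θ, 2 * Kerr.rPlus (M i) 0 + 2 ≤ ρ θ := fun θ ↦ by
    have h1 := hρr θ; have h2 := hrj i; rw [hr] at h1; linarith
  have hρsep' : ∀ θ, T < θ → ∀ j ≠ i, 2 * ρ θ + Kerr.rPlus (M j) 0 ≤ ‖ξ i θ - ξ j θ‖ := by
    intro θ hθ j hj
    have h1 := hT' θ ((le_max_left _ _).trans hθ.le) j hj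
    have h2 := hrj j
    rw [hr] at h1
    linarith [hsum0]
  have himg := fun x (hx : Kerr.rPlus (M i) 0 < ‖E4.spatial ((Lorentz.boost V hV : E4 ≃L[ℝ] E4).symm x)‖) ↦
    fermiMap_late_and_radii i M Λ ξ v hfut hvΛ hV hA hσ1 hGid hGgt hGle hGlt hρ0 (hv1 i) hρr' hρsep' x hx
  have hrp : 0 < Kerr.rPlus (M i) 0 := by
    have h1 : 0 ≤ √(M i ^ 2 - 0 ^ 2) := Real.sqrt_nonneg _
    show 0 < M i + √(M i ^ 2 - 0 ^ 2)
    linarith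
  have hAU : ∀ y ∈ boostedKerrExterior (Lorentz.boost V hV) 0 (M i) 0, A y ∈ U := by
    intro y hy
    have hy' : Kerr.rPlus (M i) 0 < ‖E4.spatial ((Lorentz.boost V hV : E4 ≃L[ℝ] E4).symm y)‖ := by
      have h := mem_boostedKerrExterior.mp hy
      rw [Kerr.mem_exterior, max_eq_left hrp.le, poincareInv_zero, Kerr.radius_zero_left] at h
      exact h
    obtain ⟨hT1, hrad⟩ := himg y hy'
    refine hU ⟨(le_max_right _ _).trans_lt hT1, fun j ↦ (hrin j).trans (hrad j)⟩
  -- the package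
  refine ⟨T, ρ, A, hAU, le_max_right _ _, ?_, ?_, hρc, hρt, hρ0, ?_, fun x hx ↦ (himg x hx).2, ?_, ?_⟩
  · exact contDiff_fermiMap hV hA hσ hGt hρc hρ0 (hξ i) (hv i) (hv1 i)
  · exact isOpenEmbedding_fermiMap' hV hA hσ hσ' hGt hGm hGd hρc hρ0 (hξ i) (hv i) (hv1 i)
  · exact fun x ↦ ⟨lt_fermiMap_apply_zero hV hA hσ1 x, norm_spatial_fermiMap_sub_lt hV hA hGlt hρ0 (hv1 i) x⟩
  · exact fun x hx hy ↦ fermiMap_eq_of_honest hV hA hσid hGid hρ0 hx hy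
  · intro ψ hψ R
    have hAc : ContDiff ℝ ∞ A := contDiff_fermiMap hV hA hσ hGt hρc hρ0 (hξ i) (hv i) (hv1 i)
    exact tendsto_truncDeviationCk_holeChart' 𝓢 i M ξ v hv1 hV
      (Ah := fun x ↦ E4.ofTimeSpace (x 0) (ξ i (x 0) +
        (ContinuousLinearMap.id ℝ E3 - (Lorentz.gamma (v i (x 0)) / (Lorentz.gamma (v i (x 0)) + 1)) •
          (innerSL ℝ (v i (x 0))).smulRight (v i (x 0)))
          (E4.spatial ((Lorentz.boost V hV : E4 ≃L[ℝ] E4).symm x))))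
      (fun _ ↦ rfl)
      (H := fun j z ↦ boostedKerrBilin (Lorentz.boost (v j (z 0)) (hv1 j (z 0)))
        (E4.ofTimeSpace (z 0) (ξ j (z 0))) (M j) 0 z - Minkowski.bilin) (fun _ _ ↦ rfl)
      (Bb := fun z ↦ Minkowski.bilin + ∑ j, (boostedKerrBilin (Lorentz.boost (v j (z 0)) (hv1 j (z 0)))
        (E4.ofTimeSpace (z 0) (ξ j (z 0))) (M j) 0 z - Minkowski.bilin)) (fun _ ↦ rfl)
      hξ hv U Φ hΦ hAc hAU hψ Λ hfut hvΛ hdev hκ₀ hvs hvb hξb hsep hMi hvV hξV hξ0 hv0 hρt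
      hρc.continuous (T₁ := T) (fun x hx hy ↦ by
        rw [fermiMap_eq_of_honest hV hA hσid hGid hρ0 hx hy, restOffsetCLM_apply]) R

-- long statement
set_option maxHeartbeats 800000 in
/-- Registered sub-goal form (stub `hole_chart_package` of the crux item) of `hole_chart_package'`.
[folklore] -/
theorem hole_chart_package : open Literature.Geometry.Lorentzian Filter Topology in ∀ (𝓢 : Spacetime 4) {N : ℕ} (i : Fin N) (M : Fin N → ℝ) (Λ : Fin N → ℝ → lorentzGroup) (ξ v : Fin N → ℝ → E3), (∀ j t, 0 < (((Λ j t : E4 ≃L[ℝ] E4) (E4.basisVector 0)) 0)) → (∀ j t, E4.spatial ((Λ j t : E4 ≃L[ℝ] E4) (E4.basisVector 0)) = (((Λ j t : E4 ≃L[ℝ] E4) (E4.basisVector 0)) 0) • v j t) → ∀ (U : Opens E4) (Φ : U → 𝓢.carrier), ContMDiff 𝓘(ℝ, E4) (𝓡 4) ((⊤ : ℕ∞) : WithTop ℕ∞) Φ → Tendsto (fun t ↦ 𝓢.deviationCk ⟨U, fun x ↦ Minkowski.bilin + ∑ j, (boostedKerrBilin (Λ j (x 0)) (E4.ofTimeSpace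 (x 0) (ξ j (x 0))) (M j) 0 x - Minkowski.bilin), fun x ↦ x 0, E4.spatialNorm⟩ Φ 2 t) atTop (𝓝 0) → ∀ {κ₀ : ℝ}, κ₀ < 1 → (∀ j t, ‖v j t‖ ≤ κ₀) → (∀ j, ContDiff ℝ ((⊤ : ℕ∞) : WithTop ℕ∞) (v j)) → (∀ j, ContDiff ℝ ((⊤ : ℕ∞) : WithTop ℕ∞) (ξ j)) → ∀ {Γ T₀ : ℝ}, (∀ j t, T₀ ≤ t → ∀ l, 1 ≤ l → l ≤ 2 → ‖iteratedDeriv l (v j) t‖ ≤ Γ) → (∀ j t, T₀ ≤ t → ∀ l, 1 ≤ l → l ≤ 2 → ‖iteratedDeriv l (ξ j) t‖ ≤ Γ) → (∀ j ≠ i, Tendsto (fun t ↦ ‖ξ i t - ξ j t‖) atTop atTop) → 0 < M i → ∀ {V : E3} (hV : ‖V‖ < 1), Tendsto (v i) atTop (𝓝 V) → Tendsto (deriv (ξ i)) atTop (𝓝 V) → (∀ l, 2 ≤ l → l ≤ 3 → Tendsto (fun t ↦ iteratedDeriv l (ξ i) t) atTop (𝓝 0)) → (∀ l, 1 ≤ l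 → l ≤ 3 → Tendsto (fun t ↦ iteratedDeriv l (v i) t) atTop (𝓝 0)) → ∀ {τ₀ : ℝ} {rin : Fin N → ℝ}, (∀ j, rin j < Kerr.rPlus (M j) 0) → {x : E4 | τ₀ < x 0 ∧ ∀ j, rin j < Kerr.radius 0 (poincareInv (Λ j (x 0)) (E4.ofTimeSpace (x 0) (ξ j (x 0))) x)} ⊆ (U : Set E4) → ∃ (T : ℝ) (ρ : ℝ → ℝ) (A : E4 → E4) (hAU : ∀ y ∈ boostedKerrExterior (Lorentz.boost V hV) 0 (M i) 0, A y ∈ U), τ₀ ≤ T ∧ ContDiff ℝ ((⊤ : ℕ∞) : WithTop ℕ∞) A ∧ Topology.IsOpenEmbedding A ∧ ContDiff ℝ ((⊤ : ℕ∞) : WithTop ℕ∞) ρ ∧ Tendsto ρ atTop atTop ∧ (∀ t, 0 < ρ t) ∧ (∀ x : E4, T < A x 0 ∧ ‖E4.spatial (A x) - ξ i (A x 0)‖ < 2 * ρ (A x 0)) ∧ (∀ x : E4, Kerr.rPlus (M i) 0 < ‖E4.spatial ((Lorentz.boost V hV : E4 ≃L[ℝ] E4).symm x)‖ → ∀ j,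 Kerr.rPlus (M j) 0 < Kerr.radius 0 (poincareInv (Λ j (A x 0)) (E4.ofTimeSpace (A x 0) (ξ j (A x 0))) (A x))) ∧ (∀ x : E4, T + 1 ≤ x 0 → ‖E4.spatial ((Lorentz.boost V hV : E4 ≃L[ℝ] E4).symm x)‖ ≤ ρ (x 0) / 2 → A x = E4.ofTimeSpace (x 0) (ξ i (x 0) + (E4.spatial ((Lorentz.boost V hV : E4 ≃L[ℝ] E4).symm x) - (Lorentz.gamma (v i (x 0)) / (Lorentz.gamma (v i (x 0)) + 1) * inner ℝ (v i (x 0)) (E4.spatial ((Lorentz.boost V hV : E4 ≃L[ℝ] E4).symm x))) • v i (x 0)))) ∧ ∀ (ψ : boostedKerrExterior (Lorentz.boost V hV) 0 (M i) 0 → 𝓢.carrier), (∀ y, ψ y = Φ ⟨A y.1, hAU y.1 y.2⟩) → ∀ R : ℝ, Tendsto (fun τ ↦ 𝓢.truncDeviationCk (boostedKerrBackground (Lorentz.boost V hV) 0 (M i) 0) ψ 2 R τ) atTop (𝓝 0) :=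
  fun 𝓢 _ i M Λ ξ v hfut hvΛ U Φ hΦ hdev _ hκ₀ hvs hv hξ _ _ hvb hξb hsep hMi _ hV hvV hξV hξ0 hv0 _ _ hrin hU ↦
    hole_chart_package' 𝓢 i M Λ ξ v hfut hvΛ U Φ hΦ hdev hκ₀ hvs hv hξ hvb hξb hsep hMi hV hvV hξV hξ0 hv0 hrin hU

end Package

end Summit.FinalStateConjecture.FinalStateConjecture.Theorems

end
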